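import Summits.MatrixMultiplication.MatrixMultiplication.Theorems.AbelianSTPPCensusGW2Sound
import Summits.MatrixMultiplication.MatrixMultiplication.Theorems.AbelianSTPPCensusGW2Check
import Summits.MatrixMultiplication.MatrixMultiplication.Theorems.AbelianSTPPCensusQuartetWitnesses

/-!
# Rule U11-GW2 kills the first quartet-alive T_E list: `(7,7,7)⁴ + (5,6,6)` at `594 = 2·297`

Cell mm-stpp (rung F-M1), theory lane «past the quartet's walls» (seat mm-stpp-theory, gen 16).  The champion list of record of tier
T_E (`τ = 5/2`) past the trio's walls, `(7,7,7)⁴ + (5,6,6)` at order `594` — quartet-admissible (`SieveAdmissible ∧ U11GPrime ∧ TAKnap575.E3Adm ∧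
FP2.FP2Adm`), E3K- and E3⁺-admissible, beating (`AbelianSTPPCensusQuartetWitnesses.lean`, `QuartetWall.quartetHypotheses_hold_at_594`, theory g14;
U11-G′ margin `−10`, C5-LIMITS.md) — is NOT `GW2.GW2Adm 594`: the kernel checker `GW2.check 297 226 232 226 1552 7 7 7 [3,9,11,27,33,99,297] 25`
evaluates to `true` by `decide` with kernel reduction (box bisection of the split cube: 663 certified boxes, 1 325 nodes, ≈ 15 s; exact Python twin
`HOME/mm-stpp-theory/gw2/gw2lean_twin.py`).  By `GW2.gw2Sound` no STPP family in any abelian group of order `594` has these set sizes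
(`GW2Wall.no_isSTPP_shapes_594`) — unconditionally (standard axioms; the rule's only external ingredient is the KERNEL theorem
Grynkiewicz–Wang 2026 Thm 1.8).  Why it bites here (numbers): fibring U11-G′ over the index-2 subgroup keeps the `+2t/3` of the GW constant once per
class pair (floor total `1564 > 1552 = Σ abc` at the uniform split, global U11-G′ `1542`), and `k = 297 = 3³·11` has no divisor in `(99, 297)`, so
every structural branch is excluded by size at the splits that matter (`h = 27`: `7·27 = 189 > 184 = k − z₀`; `h = 99`: `2·99 = 198 > 184`).
WHAT THIS IS NOT: no existence claim at any order, no census number or column (an instrument / rule fact: the T_E quartet frontier `594` is not a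
GW2 frontier; the next champion lists `604 = 4·151`, `606 = 2·3·101` are GW2-alive in the seat's twin, `614 = 2·307` and `626 = 2·313` GW2-dead),
no `ω` statement.
-/

set_option linter.dupNamespace false -- `MatrixMultiplication.MatrixMultiplication` (summit = problem, D-0017)
set_option autoImplicit false

namespace Summit.MatrixMultiplication.MatrixMultiplication.Theorems

namespace GW2Wall

open Finset Literature.Computability.AlgebraicComplexity STPPThreeRoomEnergy

/-! ### The kill at 594 -/

/-- The GW2 checker refutes every split of the 594 list (`k = 297`, `(P_AB, P_BC, P_CA) = (226, 232, 226)`, `Σ abc = 1552`, letter maxima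
`7, 7, 7`, all divisors `≥ 2` of `297`, fuel `25`): kernel evaluation. [original] -/
theorem check_594 : GW2.check 297 226 232 226 1552 7 7 7 [3, 9, 11, 27, 33, 99, 297] 25 = true := by
  decide +kernel

/-- **The 594 list is not `GW2Adm`.** [original] -/
theorem w594_not_gw2Adm : ¬ GW2.GW2Adm 594 (![7, 7, 7, 7, 5] : Fin 5 → ℕ) ![7, 7, 7, 7, 6] ![7, 7, 7, 7, 6] :=
  GW2.not_gw2Adm_of_check check_594 (by decide) (by decide) (by decide) (by decide) (by decide) (by decide) (by decide)

/-- **Quartet-alive (∧ E3K ∧ E3⁺, beating `τ = 5/2`), GW2-dead at 594** — the first quartet-alive list of record of tier T_E dies under rule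
U11-GW2. [original] -/
theorem quartet_alive_gw2_dead_at_594 :
    Quartet.QuartetAdm 594 (![7, 7, 7, 7, 5] : Fin 5 → ℕ) ![7, 7, 7, 7, 6] ![7, 7, 7, 7, 6] ∧
    E3kAdm 594 (![7, 7, 7, 7, 5] : Fin 5 → ℕ) ![7, 7, 7, 7, 6] ![7, 7, 7, 7, 6] ∧
    E3pAdm 594 (![7, 7, 7, 7, 5] : Fin 5 → ℕ) ![7, 7, 7, 7, 6] ![7, 7, 7, 7, 6] ∧
    Beats (5 / 2) 594 (![7, 7, 7, 7, 5] : Fin 5 → ℕ) ![7, 7, 7, 7, 6] ![7, 7, 7, 7, 6] ∧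
    ¬ GW2.GW2Adm 594 (![7, 7, 7, 7, 5] : Fin 5 → ℕ) ![7, 7, 7, 7, 6] ![7, 7, 7, 7, 6] :=
  ⟨QuartetWall.w594_quartetAdm, QuartetWall.w594_e3kAdm, QuartetWall.w594_e3pAdm, QuartetWall.w594_beats, w594_not_gw2Adm⟩

/-! ### Semantic reading -/

/-- **From a GW2 kill to «no STPP family with these shapes».**  If the shape list `(a, b, c)` (all entries positive) is not `GW2Adm M`, then no
STPP family `(A_i, B_i, C_i)_{i<N}` in a finite abelian group of order `M` has `|A_i| = a_i`, `|B_i| = b_i`, `|C_i| = c_i` (by `GW2.gw2Sound`).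
[original] -/
theorem no_isSTPP_of_not_gw2Adm {N M : ℕ} {a b c : Fin N → ℕ} (hk : ¬ GW2.GW2Adm M a b c)
    (hpos : ∀ i, 0 < a i ∧ 0 < b i ∧ 0 < c i) :
    ∀ (H : Type) [AddCommGroup H] [Fintype H], Fintype.card H = M → ∀ (A B C : Fin N → Finset H), IsSTPP A B C →
      ¬ ((fun i => (A i).card) = a ∧ (fun i => (B i).card) = b ∧ (fun i => (C i).card) = c) := by
  intro H _ _ hH A B C h hs
  obtain ⟨ha, hb, hc⟩ := hs
  have hne : ∀ i, (A i).Nonempty ∧ (B i).Nonempty ∧ (C i).Nonempty := fun i =>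
    ⟨card_pos.mp (by rw [show (A i).card = a i from congrFun ha i]; exact (hpos i).1),
     card_pos.mp (by rw [show (B i).card = b i from congrFun hb i]; exact (hpos i).2.1),
     card_pos.mp (by rw [show (C i).card = c i from congrFun hc i]; exact (hpos i).2.2)⟩
  have hU := GW2.gw2Sound H N A B C h hne
  rw [hH, ha, hb, hc] at hU
  exact hk hU

/-- **No STPP family in an abelian group of order `594` has the size vectors of `(7,7,7)⁴ + (5,6,6)`** — unconditional. [original] -/
theorem no_isSTPP_shapes_594 : ∀ (H : Type) [AddCommGroup H] [Fintype H], Fintype.card H = 594 →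
    ∀ (A B C : Fin 5 → Finset H), IsSTPP A B C →
      ¬ ((fun i => (A i).card) = ![7, 7, 7, 7, 5] ∧ (fun i => (B i).card) = ![7, 7, 7, 7, 6] ∧
         (fun i => (C i).card) = ![7, 7, 7, 7, 6]) :=
  no_isSTPP_of_not_gw2Adm w594_not_gw2Adm (by decide)

end GW2Wall

end Summit.MatrixMultiplication.MatrixMultiplication.Theorems
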